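import Literature.Probability.Percolation.GladkovThreePointBoundProofs
import Literature.Probability.Percolation.DecisionTreeWeightedMeasure
import HarnessLib

/-!
# Gladkov's three-point bound `P(abc)² ≤ 8 P(ab) P(ac) P(bc)` with inhomogeneous edge weights

Topic `Literature/Probability/Percolation`. Proofs-only companion of `GladkovThreePointBound.lean`
/ `GladkovThreePointBoundProofs.lean`. Source: N. Gladkov, *Percolation Inequalities and Decision
Trees*, arXiv:2408.08457v2 (2024) [Gladkov2024], Thm. 1.1 (p. 2) = Thm. 6.2 (13) (p. 8), proof
§6.2 (pp. 9–10), in the generality in which it is PRINTED: "`P` is the probability in a Bernoulli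
bond percolation model where each edge `e ∈ E` is assigned a probability `p_e` of being open"
(p. 2). The tree's discharge `gladkov2024_thm_6_2_holds` is for the homogeneous measure
`bondPercolation G p`; the route `PercNearOneGluing` (Kozma–Nitzan's Conjecture 3,
`KozmaNitzanReduction.lean`) lives on finite WEIGHTED graphs, `prodBernoulli w` with
`w : Sym2 V → [0,1]`, hence this file. Everything here is PROVED.

The combinatorics of §6.2 (the depth-first exploration `Gladkov.dfsTree`, the events `R_b, R_c`,
the path surgery `Gladkov.mem_treeDsq_union`) is weight-free and imported verbatim; only the two
probabilistic steps are redone with the coordinate-wise weights `PrW D p`, `Pr2W D p` of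
`DecisionTreeWeighted.lean` (decision-tree vdBK `Pr2W_treeDsq_le` = Thm. 4.3, Cauchy–Schwarz
`sq_PrW_le_PrW_mul_Pr2W_bothIn` = Thm. 5.2), and the finite weighted probabilities are identified
with `prodBernoulli w` by `DecisionTree.prodBernoulli_real_eq_PrW` (all pairs of a finite vertex
type form a finite coordinate set, so no passage to the limit is needed).

* `Gladkov.sq_PrW_inter_R_le` — the four inequalities for one target, weighted;
* `Gladkov.sq_PrW_conn_inter_conn_le` — (13) for weighted configurations among a finite `D`;
* `gladkov2024_thm_1_1_prodBernoulli` — **Thm. 1.1 for `prodBernoulli w` on a finite vertex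
  type**: `P(a↔b, a↔c)² ≤ 8 P(a↔b) P(a↔c) P(b↔c)` for distinct `a, b, c`.

## References

* N. Gladkov, *Percolation Inequalities and Decision Trees*, arXiv:2408.08457v2 (2024): Thm. 1.1
  (p. 2), Thm. 6.2 (13) (p. 8), §6.2 (pp. 9–10). [Gladkov2024]
-/

noncomputable section

namespace Literature.Probability.Percolation

namespace Gladkov

open Finset DecisionTree

variable {V : Type*} [DecidableEq V] {D : Finset (Sym2 V)} {a b c : V} {p : Sym2 V → ℝ}

/-- **One target, inhomogeneous weights** (`t ∈ {b, c}`, `t'` the other): with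
`B = R_t ∩ {a ↔ b} ∩ {a ↔ c}`, `P(B)² ≤ P(at) · 2 P(at') P(tt')` — Thm. 5.2, `P(R_t) ≤ P(at)`, the
surgery (16) and Thm. 4.3, exactly as in `sq_Pr_inter_R_le`. [cite: Gladkov2024, §6.2 (proof of (13))] -/
theorem sq_PrW_inter_R_le (hp0 : ∀ i, 0 ≤ p i) (hp1 : ∀ i, p i ≤ 1) (hab : a ≠ b) (hac : a ≠ c)
    (hbc : b ≠ c) {t t' : V} (htt' : (t = b ∧ t' = c) ∨ (t = c ∧ t' = b)) :
    PrW D p (conn a b ∩ conn a c ∩ R D a b c t) ^ 2 ≤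
      PrW D p (conn a t) * (2 * PrW D p (conn a t') * PrW D p (conn t t')) := by
  set B := conn a b ∩ conn a c ∩ R D a b c t with hB
  have hBA : B ⊆ R D a b c t := Set.inter_subset_right
  have hBt' : B ⊆ conn a t' := by
    rcases htt' with ⟨-, rfl⟩ | ⟨-, rfl⟩
    · exact fun K hK => hK.1.2
    · exact fun K hK => hK.1.1
  have hSD := selfDetermined_revealed (dfsTree D a b c)
  -- Theorem 5.2
  have h52 := sq_PrW_le_PrW_mul_Pr2W_bothIn D hp0 hp1 hSD (localOn_R (D := D) (a := a) (b := b)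
    (c := c) t) hBA
  -- `P(R_t) ≤ P(at)`
  have hRt : PrW D p (R D a b c t) ≤ PrW D p (conn a t) :=
    PrW_mono D hp0 hp1 fun K _ hK => mem_conn_of_mem_R hab hac hbc hK
  -- surgery + Theorem 4.3
  have hE : Pr2W D p (bothIn (revealed (dfsTree D a b c)) B) ≤
      2 * PrW D p (conn a t') * PrW D p (conn t t') := by
    have hsub : ∀ x : Finset (Sym2 V) × Finset (Sym2 V), x.1 ⊆ D → x.2 ⊆ D →
        x ∈ bothIn (revealed (dfsTree D a b c)) B →
          x ∈ treeDsq ∅ (dfsTree D a b c) (conn t' a) (conn t' t) ∪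
            treeDsq ∅ (dfsTree D a b c) (conn t' t) (conn t' a) := by
      rintro ⟨K₁, K₂⟩ hK₁ hK₂ ⟨hK₁B, hK₃B⟩
      have hR : K₁ ∈ R D a b c t := hBA hK₁B
      have ht'vis : t' ∉ (fin D a b c K₁).vis := by
        obtain ⟨rest, -, h⟩ := stack_of_mem_R hab hac hbc hR
        rcases htt' with ⟨rfl, rfl⟩ | ⟨rfl, rfl⟩
        · rcases h with ⟨-, h⟩ | ⟨h, -⟩
          · exact h
          · exact absurd h hbc
        · rcases h with ⟨h, -⟩ | ⟨-, h⟩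
          · exact absurd h.symm hbc
          · exact h
      exact mem_treeDsq_union hab hac hbc hK₁ hK₂ hR ht'vis (hBt' hK₁B) (hBt' hK₃B)
    calc Pr2W D p (bothIn (revealed (dfsTree D a b c)) B)
        ≤ Pr2W D p (treeDsq ∅ (dfsTree D a b c) (conn t' a) (conn t' t) ∪
            treeDsq ∅ (dfsTree D a b c) (conn t' t) (conn t' a)) := Pr2W_mono D hp0 hp1 hsub
      _ ≤ Pr2W D p (treeDsq ∅ (dfsTree D a b c) (conn t' a) (conn t' t)) +
            Pr2W D p (treeDsq ∅ (dfsTree D a b c) (conn t' t) (conn t' a)) :=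
          Pr2W_union_le D hp0 hp1 _ _
      _ ≤ PrW D p (conn t' a) * PrW D p (conn t' t) + PrW D p (conn t' t) * PrW D p (conn t' a) :=
          add_le_add (Pr2W_treeDsq_le D hp0 hp1 _ (isUpperSet_conn _ _) (isUpperSet_conn _ _))
            (Pr2W_treeDsq_le D hp0 hp1 _ (isUpperSet_conn _ _) (isUpperSet_conn _ _))
      _ = 2 * PrW D p (conn a t') * PrW D p (conn t t') := by
          rw [conn_comm t' a, conn_comm t' t]; ring
  calc PrW D p B ^ 2 ≤ PrW D p (R D a b c t) * Pr2W D p (bothIn (revealed (dfsTree D a b c)) B) := h52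
    _ ≤ PrW D p (conn a t) * (2 * PrW D p (conn a t') * PrW D p (conn t t')) :=
        mul_le_mul hRt hE (Pr2W_nonneg D hp0 hp1 _) (PrW_nonneg D hp0 hp1 _)

/-- **Gladkov 2024, Theorem 6.2 (13), finite case with inhomogeneous weights**: for
configurations of open edges among a finite set `D` of edges, each edge `e` open with its own
probability `p_e ∈ [0, 1]`, and distinct vertices `a, b, c`,
`P(a ↔ b, a ↔ c)² ≤ 8 P(a ↔ b) P(a ↔ c) P(b ↔ c)`. [cite: Gladkov2024, Thm. 6.2 (13) (finite G, arbitrary p_e)] -/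
theorem sq_PrW_conn_inter_conn_le (D : Finset (Sym2 V)) {p : Sym2 V → ℝ} (hp0 : ∀ i, 0 ≤ p i)
    (hp1 : ∀ i, p i ≤ 1) {a b c : V} (hab : a ≠ b) (hac : a ≠ c) (hbc : b ≠ c) :
    PrW D p (conn a b ∩ conn a c) ^ 2 ≤
      8 * PrW D p (conn a b) * PrW D p (conn a c) * PrW D p (conn b c) := by
  set xb := PrW D p (conn a b ∩ conn a c ∩ R D a b c b)
  set xc := PrW D p (conn a b ∩ conn a c ∩ R D a b c c)
  have hsplit : PrW D p (conn a b ∩ conn a c) ≤ xb + xc := by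
    refine (PrW_mono D hp0 hp1 fun K hKD hK => ?_).trans (PrW_union_le D hp0 hp1 _ _)
    rcases mem_R_or_mem_R_of_mem_conn hab hac hbc hKD (Or.inl rfl) hK.1 with h | h
    · exact Or.inl ⟨hK, h⟩
    · exact Or.inr ⟨hK, h⟩
  have hb2 : xb ^ 2 ≤ PrW D p (conn a b) * (2 * PrW D p (conn a c) * PrW D p (conn b c)) :=
    sq_PrW_inter_R_le hp0 hp1 hab hac hbc (Or.inl ⟨rfl, rfl⟩)
  have hc2 : xc ^ 2 ≤ PrW D p (conn a c) * (2 * PrW D p (conn a b) * PrW D p (conn c b)) :=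
    sq_PrW_inter_R_le hp0 hp1 hab hac hbc (Or.inr ⟨rfl, rfl⟩)
  rw [conn_comm c b] at hc2
  have h0 : 0 ≤ PrW D p (conn a b ∩ conn a c) := PrW_nonneg D hp0 hp1 _
  have hxb : 0 ≤ xb := PrW_nonneg D hp0 hp1 _
  have hxc : 0 ≤ xc := PrW_nonneg D hp0 hp1 _
  calc PrW D p (conn a b ∩ conn a c) ^ 2 ≤ (xb + xc) ^ 2 := pow_le_pow_left₀ h0 hsplit 2
    _ ≤ 2 * xb ^ 2 + 2 * xc ^ 2 := by nlinarith [sq_nonneg (xb - xc)]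
    _ ≤ 2 * (PrW D p (conn a b) * (2 * PrW D p (conn a c) * PrW D p (conn b c))) +
          2 * (PrW D p (conn a c) * (2 * PrW D p (conn a b) * PrW D p (conn b c))) := by
        gcongr
    _ = 8 * PrW D p (conn a b) * PrW D p (conn a c) * PrW D p (conn b c) := by ring

end Gladkov

open MeasureTheory Literature.Probability.LatticeModels in
/-- **Gladkov 2024, Theorem 1.1 = Theorem 6.2 (13) for finite weighted graphs** (`prodBernoulli w`,
each pair `e` of a finite vertex type open independently with probability `w e`; the printed
generality "each edge `e ∈ E` is assigned a probability `p_e`", p. 2, on the finite complete graph):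
for distinct `a, b, c`, `P(a ↔ b, a ↔ c)² ≤ 8 · P(a ↔ b) · P(a ↔ c) · P(b ↔ c)`.  From the finite
weighted form `Gladkov.sq_PrW_conn_inter_conn_le` with `D` = all pairs, via the law of the
finite-dimensional marginal `DecisionTree.prodBernoulli_real_eq_PrW`.
[cite: Gladkov2024, Thm. 1.1 (p. 2) and Thm. 6.2 (13) (p. 8), arXiv:2408.08457] -/
theorem gladkov2024_thm_1_1_prodBernoulli {V : Type*} [Fintype V] (w : Sym2 V → unitInterval)
    {a b c : V} (hab : a ≠ b) (hac : a ≠ c) (hbc : b ≠ c) :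
    ((prodBernoulli w).real (openConn a b ∩ openConn a c)) ^ 2 ≤
      8 * (prodBernoulli w).real (openConn a b) * (prodBernoulli w).real (openConn a c) *
        (prodBernoulli w).real (openConn b c) := by
  classical
  set D : Finset (Sym2 V) := Finset.univ with hD
  set p : Sym2 V → ℝ := fun e => (w e : ℝ) with hp
  have hp0 : ∀ e, 0 ≤ p e := fun e => (w e).2.1
  have hp1 : ∀ e, p e ≤ 1 := fun e => (w e).2.2
  have hdet : ∀ C : Set (BondConfig V), DeterminedBy C (↑D : Set (Sym2 V)) := by
    intro C
    rw [determinedBy_iff]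
    intro ω ω' h
    rw [hD, Finset.coe_univ, Set.inter_univ, Set.inter_univ] at h
    rw [h]
  have key : ∀ x y : V, (prodBernoulli w).real (openConn x y) = DecisionTree.PrW D p (Gladkov.conn x y) := by
    intro x y
    exact DecisionTree.prodBernoulli_real_eq_PrW w (hdet _) fun S _ => Iff.rfl
  have key2 : (prodBernoulli w).real (openConn a b ∩ openConn a c) =
      DecisionTree.PrW D p (Gladkov.conn a b ∩ Gladkov.conn a c) :=
    DecisionTree.prodBernoulli_real_eq_PrW w (hdet _) fun S _ => Iff.rfl
  rw [key, key, key, key2]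
  exact Gladkov.sq_PrW_conn_inter_conn_le D hp0 hp1 hab hac hbc

end Literature.Probability.Percolation

end
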